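import Summits.ResolutionOfSingularities.ResolutionOfSingularities.Theorems.PurelyInseparableDim4JointMixedComputations
import HarnessLib

/-!
# Purely inseparable four-folds: the MIXED instance — the LEAF `(x₁, (0,1,0,0))` over the 3-fold and the four charts of its point
# blow-up (brick S3 (c) «joint point∘coordinate chains», part 30b, cell `res-dim4-pi`)

[OURS · counted 0] (D-0157 DOOR 2; desk WORD #66 (4)(c), #74 (g), #99 (d); frame `PIDim4.TerminationImpliesOrderReduction`,
S3 (c); host item stmt-ResolutionOfSingularities-16155, helper). Nothing here proves resolution of singularities in
dimension ≥ 4 / characteristic `p` — NOT here, not anywhere in this programme.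

`G = x₂^{2p}x₃ − x₂^p x₃ + x₂^p x₃^p x₄ + x₁ x₂^p x₄^p + x₁^p x₂` (part 30a). Re-centred at the leaf `(0, 1, 0, 0)`:
`G(x + e₂) = L + x₁^p`, `L = x₂^{2p}x₃ + x₂^p x₃ + x₂^p x₃^p x₄ + x₃^p x₄ + x₁ x₂^p x₄^p + x₁ x₄^p + x₁^p x₂` (`translate_leaf_G_mixed`), so the
leaf STATE is `L` after cleaning (`step_F_leaf_mixed`). Every monomial of `L` has degree `≥ p + 1`; the chart `y_k` of the POINT blow-up
reads `y_k · R_k` (`chartTransform_univ_…_L_mixed`) with `∂R₁/∂y₂ = ∂R₂/∂y₃ = ∂R₃/∂y₄ = ∂R₄/∂y₁ = 1` at every point of the exceptional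
hyperplane, whence **`not_isEquimultiplePoint_L_mixed`** (`p ≥ 3`): the leaf is DEAD.

AI-produced formalisation, weaker than expert review. bears_on: LADDER-RESOLUTION:D157-DOOR2 (res-dim4-pi · S3 (c) joint v2 · mixed
instance, leaf).
-/

set_option linter.dupNamespace false -- D-0017: single-problem summit path `Summit.<S>.<S>.…` by design

noncomputable section

open MvPolynomial Finset CategoryTheory AlgebraicGeometry Opposite TopologicalSpace

namespace Summit.ResolutionOfSingularities.ResolutionOfSingularities.Theorems.PIDim4

open Literature.AlgebraicGeometry.Resolution
open Literature.AlgebraicGeometry.Resolution.Hauser2010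
open Literature.AlgebraicGeometry.Resolution.AffinePointBlowup (P A γ coord Wtop ξ)

namespace Equimultiple

section MixedLeaf

variable {K : Type} [Field K] {p : ℕ} [hp : Fact p.Prime] [CharP K p]

/-! ## §1 The leaf state `L` -/

/-- **`G(x + e₂) = L + x₁^p`.** [cite: Hauser2010, §F (the point a′ of the exceptional divisor; translation)] -/
theorem translate_leaf_G_mixed :
    PointBlowup.translate (Pi.single 1 1 : Fin 4 → K)
        (X 1 ^ (2 * p) * X 2 - X 1 ^ p * X 2 + X 1 ^ p * X 2 ^ p * X 3 + X 0 * X 1 ^ p * X 3 ^ p + X 0 ^ p * X 1 :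
          MvPolynomial (Fin 4) K) =
      (X 1 ^ (2 * p) * X 2 + X 1 ^ p * X 2 + X 1 ^ p * X 2 ^ p * X 3 + X 2 ^ p * X 3 + X 0 * X 1 ^ p * X 3 ^ p + X 0 * X 3 ^ p +
        X 0 ^ p * X 1) + X 0 ^ p := by
  unfold PointBlowup.translate
  simp only [map_add, map_sub, map_mul, map_pow, aeval_X, Pi.single_eq_same, C_1,
    Pi.single_eq_of_ne (show (0 : Fin 4) ≠ 1 by decide), Pi.single_eq_of_ne (show (2 : Fin 4) ≠ 1 by decide),
    Pi.single_eq_of_ne (show (3 : Fin 4) ≠ 1 by decide), C_0, add_zero]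
  have h1p : ((X 1 : MvPolynomial (Fin 4) K) + 1) ^ p = X 1 ^ p + 1 := by rw [add_pow_char, one_pow]
  rw [mul_comm 2 p, pow_mul, pow_mul, h1p]
  ring

omit hp [CharP K p] in
/-- `L` as a sum of seven monomials. [folklore] -/
theorem L_mixed_eq_monomial_add :
    (X 1 ^ (2 * p) * X 2 + X 1 ^ p * X 2 + X 1 ^ p * X 2 ^ p * X 3 + X 2 ^ p * X 3 + X 0 * X 1 ^ p * X 3 ^ p + X 0 * X 3 ^ p +
        X 0 ^ p * X 1 : MvPolynomial (Fin 4) K) =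
      monomial (Finsupp.single 1 (2 * p) + Finsupp.single 2 1) 1 + monomial (Finsupp.single 1 p + Finsupp.single 2 1) 1 +
        monomial (Finsupp.single 1 p + Finsupp.single 2 p + Finsupp.single 3 1) 1 + monomial (Finsupp.single 2 p + Finsupp.single 3 1) 1 +
        monomial (Finsupp.single 0 1 + Finsupp.single 1 p + Finsupp.single 3 p) 1 + monomial (Finsupp.single 0 1 + Finsupp.single 3 p) 1 +
        monomial (Finsupp.single 0 p + Finsupp.single 1 1) 1 := by
  have h1 : (X 1 ^ (2 * p) * X 2 : MvPolynomial (Fin 4) K) = monomial (Finsupp.single 1 (2 * p) + Finsupp.single 2 1) 1 := by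
    rw [X_pow_eq_monomial, X, monomial_mul, mul_one]
  have h3 : (X 1 ^ p * X 2 ^ p * X 3 : MvPolynomial (Fin 4) K) =
      monomial (Finsupp.single 1 p + Finsupp.single 2 p + Finsupp.single 3 1) 1 := by
    rw [X_pow_eq_monomial, X_pow_eq_monomial, X, monomial_mul, monomial_mul, mul_one, mul_one]
  have h5 : (X 0 * X 1 ^ p * X 3 ^ p : MvPolynomial (Fin 4) K) =
      monomial (Finsupp.single 0 1 + Finsupp.single 1 p + Finsupp.single 3 p) 1 := by
    rw [X_pow_eq_monomial, X_pow_eq_monomial, X, monomial_mul, monomial_mul, mul_one, mul_one]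
  have h6 : (X 0 * X 3 ^ p : MvPolynomial (Fin 4) K) = monomial (Finsupp.single 0 1 + Finsupp.single 3 p) 1 := by
    rw [X_pow_eq_monomial, X, monomial_mul, mul_one]
  rw [h1, X_pow_mul_X_eq_monomial, h3, X_pow_mul_X_eq_monomial, h5, h6, X_pow_mul_X_eq_monomial]

omit hp [CharP K p] in
/-- The support of `L` lies in its seven exponents. [folklore] -/
theorem mem_support_L_mixed {d : Fin 4 →₀ ℕ}
    (hd : d ∈ (X 1 ^ (2 * p) * X 2 + X 1 ^ p * X 2 + X 1 ^ p * X 2 ^ p * X 3 + X 2 ^ p * X 3 + X 0 * X 1 ^ p * X 3 ^ p + X 0 * X 3 ^ p +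
      X 0 ^ p * X 1 : MvPolynomial (Fin 4) K).support) :
    d = Finsupp.single 1 (2 * p) + Finsupp.single 2 1 ∨ d = Finsupp.single 1 p + Finsupp.single 2 1 ∨
      d = Finsupp.single 1 p + Finsupp.single 2 p + Finsupp.single 3 1 ∨ d = Finsupp.single 2 p + Finsupp.single 3 1 ∨
      d = Finsupp.single 0 1 + Finsupp.single 1 p + Finsupp.single 3 p ∨ d = Finsupp.single 0 1 + Finsupp.single 3 p ∨
      d = Finsupp.single 0 p + Finsupp.single 1 1 := by
  rw [L_mixed_eq_monomial_add] at hd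
  rcases Finset.mem_union.mp (Finset.mem_of_subset MvPolynomial.support_add hd) with h₁ | h₁
  · rcases Finset.mem_union.mp (Finset.mem_of_subset MvPolynomial.support_add h₁) with h₂ | h₂
    · rcases Finset.mem_union.mp (Finset.mem_of_subset MvPolynomial.support_add h₂) with h₃ | h₃
      · rcases Finset.mem_union.mp (Finset.mem_of_subset MvPolynomial.support_add h₃) with h₄ | h₄
        · rcases Finset.mem_union.mp (Finset.mem_of_subset MvPolynomial.support_add h₄) with h₅ | h₅
          · rcases Finset.mem_union.mp (Finset.mem_of_subset MvPolynomial.support_add h₅) with h₆ | h₆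
            · exact Or.inl (Finset.mem_singleton.mp (Finset.mem_of_subset support_monomial_subset h₆))
            · exact Or.inr (Or.inl (Finset.mem_singleton.mp (Finset.mem_of_subset support_monomial_subset h₆)))
          · exact Or.inr (Or.inr (Or.inl (Finset.mem_singleton.mp (Finset.mem_of_subset support_monomial_subset h₅))))
        · exact Or.inr (Or.inr (Or.inr (Or.inl (Finset.mem_singleton.mp (Finset.mem_of_subset support_monomial_subset h₄)))))
      · exact Or.inr (Or.inr (Or.inr (Or.inr (Or.inl (Finset.mem_singleton.mp (Finset.mem_of_subset support_monomial_subset h₃))))))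
    · exact Or.inr (Or.inr (Or.inr (Or.inr (Or.inr (Or.inl
        (Finset.mem_singleton.mp (Finset.mem_of_subset support_monomial_subset h₂)))))))
  · exact Or.inr (Or.inr (Or.inr (Or.inr (Or.inr (Or.inr (Finset.mem_singleton.mp (Finset.mem_of_subset support_monomial_subset h₁)))))))

omit [CharP K p] in
/-- `L` is clean (every monomial has an exponent `1`). [cite: HauserPerlega2019PRIMS, §2 (cleaning)] -/
theorem isClean_L_mixed :
    Literature.Barriers.ResolutionOfSingularities.HauserPerlega.IsClean p
      (X 1 ^ (2 * p) * X 2 + X 1 ^ p * X 2 + X 1 ^ p * X 2 ^ p * X 3 + X 2 ^ p * X 3 + X 0 * X 1 ^ p * X 3 ^ p + X 0 * X 3 ^ p +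
        X 0 ^ p * X 1 : MvPolynomial (Fin 4) K) := by
  intro d hd hpth
  have key : ∀ i : Fin 4, d i = 1 → False := fun i hi => by
    have h := hpth i (by rw [Finsupp.mem_support_iff, hi]; exact one_ne_zero)
    rw [hi] at h
    exact hp.out.one_lt.ne' (Nat.dvd_one.mp h)
  rcases mem_support_L_mixed hd with rfl | rfl | rfl | rfl | rfl | rfl | rfl
  · exact key 2 (by simp)
  · exact key 2 (by simp)
  · exact key 3 (by simp)
  · exact key 3 (by simp)
  · exact key 0 (by simp)
  · exact key 0 (by simp)
  · exact key 1 (by simp)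

omit hp [CharP K p] in
/-- Every monomial of `L` has total degree `p + 1` or `2p + 1`. [folklore] -/
theorem degree_of_mem_support_L_mixed {d : Fin 4 →₀ ℕ}
    (hd : d ∈ (X 1 ^ (2 * p) * X 2 + X 1 ^ p * X 2 + X 1 ^ p * X 2 ^ p * X 3 + X 2 ^ p * X 3 + X 0 * X 1 ^ p * X 3 ^ p + X 0 * X 3 ^ p +
      X 0 ^ p * X 1 : MvPolynomial (Fin 4) K).support) :
    CentreBlowup.degIn (Finset.univ : Finset (Fin 4)) d = p + 1 ∨ CentreBlowup.degIn (Finset.univ : Finset (Fin 4)) d = 2 * p + 1 := by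
  rw [CentreBlowup.degIn_univ]
  rcases mem_support_L_mixed hd with rfl | rfl | rfl | rfl | rfl | rfl | rfl <;>
    simp only [map_add, Finsupp.degree_single, true_or, or_true] <;> omega

/-- **The `F`-component of the LEAF state** `step p {x₁} x₁ e₂ (F, 0, ∅)` is `L` (the `p`-th power `x₁^p` is cleaned away).
[cite: Hauser2010, §§F–G] [cite: HauserPerlega2019PRIMS, §2 (cleaning)] -/
theorem step_F_leaf_mixed [DecidableEq K] :
    (CentreBlowup.step p ({0} : Finset (Fin 4)) 0 (Pi.single 1 1)
        (⟨X 0 ^ p * (X 1 ^ (2 * p) * X 2 - X 1 ^ p * X 2 + X 1 ^ p * X 2 ^ p * X 3 + X 0 * X 1 ^ p * X 3 ^ p + X 0 ^ p * X 1), 0, ∅⟩ :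
          State K)).F =
      X 1 ^ (2 * p) * X 2 + X 1 ^ p * X 2 + X 1 ^ p * X 2 ^ p * X 3 + X 2 ^ p * X 3 + X 0 * X 1 ^ p * X 3 ^ p + X 0 * X 3 ^ p +
        X 0 ^ p * X 1 := by
  show deletePthPowers p (PointBlowup.translate (Pi.single 1 1) (CentreBlowup.chartTransform p ({0} : Finset (Fin 4)) 0
    (X 0 ^ p * (X 1 ^ (2 * p) * X 2 - X 1 ^ p * X 2 + X 1 ^ p * X 2 ^ p * X 3 + X 0 * X 1 ^ p * X 3 ^ p + X 0 ^ p * X 1) :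
      MvPolynomial (Fin 4) K))) = _
  have hX0 : deletePthPowers p ((X 0 : MvPolynomial (Fin 4) K) ^ p) = 0 := by
    rw [X_pow_eq_monomial, deletePthPowers_monomial, if_pos ((isPthPowerExponent_iff _ _).mpr fun i => by
      rw [Finsupp.single_apply]; split_ifs; exacts [dvd_rfl, dvd_zero _])]
  rw [chartTransform_F_mixed, translate_leaf_G_mixed, deletePthPowers_add,
    Literature.Barriers.ResolutionOfSingularities.HauserPerlega.deletePthPowers_eq_self isClean_L_mixed, hX0, add_zero]

/-! ## §2 The four charts of the point blow-up of `L` -/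

omit hp [CharP K p] in
/-- **The `y₁`-chart of the point blow-up of `L` reads `y₁ · R₁`.** [folklore] -/
theorem chartTransform_univ_zero_L_mixed :
    CentreBlowup.chartTransform p (Finset.univ : Finset (Fin 4)) 0
        (X 1 ^ (2 * p) * X 2 + X 1 ^ p * X 2 + X 1 ^ p * X 2 ^ p * X 3 + X 2 ^ p * X 3 + X 0 * X 1 ^ p * X 3 ^ p + X 0 * X 3 ^ p +
          X 0 ^ p * X 1 : MvPolynomial (Fin 4) K) =
      X 0 * (X 0 ^ p * X 1 ^ (2 * p) * X 2 + X 1 ^ p * X 2 + X 0 ^ p * X 1 ^ p * X 2 ^ p * X 3 + X 2 ^ p * X 3 +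
        X 0 ^ p * X 1 ^ p * X 3 ^ p + X 3 ^ p + X 1) := by
  have d1 : 2 * p + 1 - p = p + 1 := by omega
  have d2 : p + 1 - p = 1 := by omega
  have d3 : p + p + 1 - p = p + 1 := by omega
  have d5 : 1 + p + p - p = p + 1 := by omega
  have d6 : 1 + p - p = 1 := by omega
  rw [L_mixed_eq_monomial_add]
  simp only [CentreBlowup.chartTransform_add, CentreBlowup.chartTransform_monomial, CentreBlowup.chartExponent, CentreBlowup.degIn_univ,
    map_add, Finsupp.degree_single, d1, d2, d3, d5, d6]
  simp only [monomial_eq, C_1, one_mul, Finsupp.prod_fintype _ _ (fun i => pow_zero _), Fin.prod_univ_four, Finsupp.coe_update,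
    Function.update_self, Function.update_of_ne, ne_eq, Fin.reduceEq, not_false_eq_true, Finsupp.coe_add, Pi.add_apply,
    Finsupp.single_apply, if_true, if_false, Fin.isValue, add_zero, zero_add, pow_zero, pow_one, mul_one, one_mul]
  ring

omit hp [CharP K p] in
/-- **The `y₂`-chart of the point blow-up of `L` reads `y₂ · R`.** [folklore] -/
theorem chartTransform_univ_one_L_mixed :
    CentreBlowup.chartTransform p (Finset.univ : Finset (Fin 4)) 1
        (X 1 ^ (2 * p) * X 2 + X 1 ^ p * X 2 + X 1 ^ p * X 2 ^ p * X 3 + X 2 ^ p * X 3 + X 0 * X 1 ^ p * X 3 ^ p + X 0 * X 3 ^ p +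
          X 0 ^ p * X 1 : MvPolynomial (Fin 4) K) =
      X 1 * (X 1 ^ p * X 2 + X 2 + X 1 ^ p * X 2 ^ p * X 3 + X 2 ^ p * X 3 + X 0 * X 1 ^ p * X 3 ^ p + X 0 * X 3 ^ p + X 0 ^ p) := by
  have d1 : 2 * p + 1 - p = p + 1 := by omega
  have d2 : p + 1 - p = 1 := by omega
  have d3 : p + p + 1 - p = p + 1 := by omega
  have d5 : 1 + p + p - p = p + 1 := by omega
  have d6 : 1 + p - p = 1 := by omega
  rw [L_mixed_eq_monomial_add]
  simp only [CentreBlowup.chartTransform_add, CentreBlowup.chartTransform_monomial, CentreBlowup.chartExponent, CentreBlowup.degIn_univ,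
    map_add, Finsupp.degree_single, d1, d2, d3, d5, d6]
  simp only [monomial_eq, C_1, one_mul, Finsupp.prod_fintype _ _ (fun i => pow_zero _), Fin.prod_univ_four, Finsupp.coe_update,
    Function.update_self, Function.update_of_ne, ne_eq, Fin.reduceEq, not_false_eq_true, Finsupp.coe_add, Pi.add_apply,
    Finsupp.single_apply, if_true, if_false, Fin.isValue, add_zero, zero_add, pow_zero, pow_one, mul_one, one_mul]
  ring

omit hp [CharP K p] in
/-- **The `y₃`-chart of the point blow-up of `L` reads `y₃ · R`.** [folklore] -/
theorem chartTransform_univ_two_L_mixed :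
    CentreBlowup.chartTransform p (Finset.univ : Finset (Fin 4)) 2
        (X 1 ^ (2 * p) * X 2 + X 1 ^ p * X 2 + X 1 ^ p * X 2 ^ p * X 3 + X 2 ^ p * X 3 + X 0 * X 1 ^ p * X 3 ^ p + X 0 * X 3 ^ p +
          X 0 ^ p * X 1 : MvPolynomial (Fin 4) K) =
      X 2 * (X 1 ^ (2 * p) * X 2 ^ p + X 1 ^ p + X 1 ^ p * X 2 ^ p * X 3 + X 3 + X 0 * X 1 ^ p * X 2 ^ p * X 3 ^ p + X 0 * X 3 ^ p +
        X 0 ^ p * X 1) := by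
  have d1 : 2 * p + 1 - p = p + 1 := by omega
  have d2 : p + 1 - p = 1 := by omega
  have d3 : p + p + 1 - p = p + 1 := by omega
  have d5 : 1 + p + p - p = p + 1 := by omega
  have d6 : 1 + p - p = 1 := by omega
  rw [L_mixed_eq_monomial_add]
  simp only [CentreBlowup.chartTransform_add, CentreBlowup.chartTransform_monomial, CentreBlowup.chartExponent, CentreBlowup.degIn_univ,
    map_add, Finsupp.degree_single, d1, d2, d3, d5, d6]
  simp only [monomial_eq, C_1, one_mul, Finsupp.prod_fintype _ _ (fun i => pow_zero _), Fin.prod_univ_four, Finsupp.coe_update,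
    Function.update_self, Function.update_of_ne, ne_eq, Fin.reduceEq, not_false_eq_true, Finsupp.coe_add, Pi.add_apply,
    Finsupp.single_apply, if_true, if_false, Fin.isValue, add_zero, zero_add, pow_zero, pow_one, mul_one, one_mul]
  ring

omit hp [CharP K p] in
/-- **The `y₄`-chart of the point blow-up of `L` reads `y₄ · R`.** [folklore] -/
theorem chartTransform_univ_three_L_mixed :
    CentreBlowup.chartTransform p (Finset.univ : Finset (Fin 4)) 3
        (X 1 ^ (2 * p) * X 2 + X 1 ^ p * X 2 + X 1 ^ p * X 2 ^ p * X 3 + X 2 ^ p * X 3 + X 0 * X 1 ^ p * X 3 ^ p + X 0 * X 3 ^ p +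
          X 0 ^ p * X 1 : MvPolynomial (Fin 4) K) =
      X 3 * (X 1 ^ (2 * p) * X 2 * X 3 ^ p + X 1 ^ p * X 2 + X 1 ^ p * X 2 ^ p * X 3 ^ p + X 2 ^ p + X 0 * X 1 ^ p * X 3 ^ p + X 0 +
        X 0 ^ p * X 1) := by
  have d1 : 2 * p + 1 - p = p + 1 := by omega
  have d2 : p + 1 - p = 1 := by omega
  have d3 : p + p + 1 - p = p + 1 := by omega
  have d5 : 1 + p + p - p = p + 1 := by omega
  have d6 : 1 + p - p = 1 := by omega
  rw [L_mixed_eq_monomial_add]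
  simp only [CentreBlowup.chartTransform_add, CentreBlowup.chartTransform_monomial, CentreBlowup.chartExponent, CentreBlowup.degIn_univ,
    map_add, Finsupp.degree_single, d1, d2, d3, d5, d6]
  simp only [monomial_eq, C_1, one_mul, Finsupp.prod_fintype _ _ (fun i => pow_zero _), Fin.prod_univ_four, Finsupp.coe_update,
    Function.update_self, Function.update_of_ne, ne_eq, Fin.reduceEq, not_false_eq_true, Finsupp.coe_add, Pi.add_apply,
    Finsupp.single_apply, if_true, if_false, Fin.isValue, add_zero, zero_add, pow_zero, pow_one, mul_one, one_mul]
  ring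

/-! ## §3 The leaf is DEAD -/

omit hp in
/-- **NO PAIR `(k, c)` WITH `c_k = 0` IS EQUIMULTIPLE FOR `(L, univ)` when `p ≥ 3`**: the monomial `y_k y_{k+1}` of degree `2 < p` has
coefficient `1` in the translated chart transform. [cite: Hauser2010, §F (equiconstant points)] -/
theorem not_isEquimultiplePoint_L_mixed [DecidableEq K] (hp3 : 3 ≤ p) (k : Fin 4) (c : Fin 4 → K) (hck : c k = 0) (s : State K)
    (hs : s.F = X 1 ^ (2 * p) * X 2 + X 1 ^ p * X 2 + X 1 ^ p * X 2 ^ p * X 3 + X 2 ^ p * X 3 + X 0 * X 1 ^ p * X 3 ^ p + X 0 * X 3 ^ p +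
          X 0 ^ p * X 1) :
    ¬ CentreBlowup.IsEquimultiplePoint p (Finset.univ : Finset (Fin 4)) k c s := by
  have hp0 : p ≠ 0 := by omega
  intro h
  unfold CentreBlowup.IsEquimultiplePoint CentreBlowup.pointTransform at h
  rw [hs] at h
  have hdeg : ∀ l : Fin 4, (Finsupp.single k 1 + Finsupp.single l 1 : Fin 4 →₀ ℕ).degree < p := fun l => by
    rw [map_add, Finsupp.degree_single, Finsupp.degree_single]; omega
  have hne : ∀ l : Fin 4, (Finsupp.single k 1 + Finsupp.single l 1 : Fin 4 →₀ ℕ) ≠ 0 := fun l h0 => by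
    have := DFunLike.congr_fun h0 k; simp at this
  obtain rfl | rfl | rfl | rfl : k = 0 ∨ k = 1 ∨ k = 2 ∨ k = 3 := by fin_cases k <;> simp
  · have h1 := h _ (hne 1) (hdeg 1)
    rw [chartTransform_univ_zero_L_mixed, coeff_pair_translate_X_mul 0 1 c hck] at h1
    simp [(pderiv (1 : Fin 4)).leibniz_pow] at h1
  · have h1 := h _ (hne 2) (hdeg 2)
    rw [chartTransform_univ_one_L_mixed, coeff_pair_translate_X_mul 1 2 c hck] at h1
    simp [(pderiv (2 : Fin 4)).leibniz_pow, hck, zero_pow hp0] at h1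
  · have h1 := h _ (hne 3) (hdeg 3)
    rw [chartTransform_univ_two_L_mixed, coeff_pair_translate_X_mul 2 3 c hck] at h1
    simp [(pderiv (3 : Fin 4)).leibniz_pow, hck, zero_pow hp0] at h1
  · have h1 := h _ (hne 0) (hdeg 0)
    rw [chartTransform_univ_three_L_mixed, coeff_pair_translate_X_mul 3 0 c hck] at h1
    simp [(pderiv (0 : Fin 4)).leibniz_pow, hck, zero_pow hp0] at h1

end MixedLeaf

end Equimultiple

end Summit.ResolutionOfSingularities.ResolutionOfSingularities.Theorems.PIDim4

end
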